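import Literature.Combinatorics.Designs.CooperWallisOD

/-!
# H(668): the Baumert–Hall / Williamson-type plug-in family at order `668 = 4·167` — the general step degenerates

Framing: lottery ticket; floor = certified bounds/negative ranges.

Cell pub-namedobj (venture DiscreteObjects), target (H), hadamard gen 25.  The classical plug-in theorem
(Baumert–Hall 1965; Seberry–Yamada 2020 §3.5, `Literature.Combinatorics.Designs.OrthogonalDesigns.plugIn_isHadamard`)
builds a Hadamard matrix of order `4tw` from a Baumert–Hall array `BH(4t; t,t,t,t)` and Williamson-type matrices
(four pairwise amicable `±1` matrices with `Σ X Xᵀ = 4w I`, SY Definition 3.2) of order `w`; Cooper–J. Wallis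
(SY Theorem 3.11 / Corollary 3.6, `Literature.Combinatorics.Designs.CooperWallis.cwCoef_isBHArray`) supply the
Baumert–Hall array from T-matrices of order `t`.  At the target order the step is DEGENERATE:
* `plugIn_orders_668` — `4·t·w = 668 ⇔ (t, w) ∈ {(1, 167), (167, 1)}` (`t·w = 167` is prime), so the family has exactly
  two leaves:
* `hadamard668_of_bhArray167` — a Baumert–Hall array of order `167` (from ANY source: T-matrices, Welch arrays, …) gives
  `H(668)` (leaf `w = 1`; none is known — SY 2020 Proposition 5.1 lists the known orders
  `{1 + 2^a10^b26^c} ∪ {1, 3, …, 33, 37, 41, 47, 51, 53, 59, 61, 65, 81, 101, 107} ∪ 5β ∪ 9β ∪ 2(q+1)β`, and `167` is a prime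
  with `166 = 2·83`);
* `hadamard668_of_williamsonType167` — Williamson-TYPE matrices of order `167` in Seberry–Yamada's sense (pairwise
  amicable; no circulant or symmetric structure assumed) give `H(668)` through the Williamson array (leaf `t = 1`,
  SY Theorem 3.2; the order-`1` Baumert–Hall array is the `OD(4; 1,1,1,1)` = Williamson array, `bhArray_one`); this leaf
  contains family F1 (Williamson sequences of length 167, `WilliamsonSequences167Iff668`);
* `hadamard668_of_tmatrixRows_williamsonType` — the general Corollary 3.6 instance: T-matrices of order `t` and
  Williamson-type matrices of order `w` with `4tw = 668` give `H(668)`, and then `(t, w)` is one of the two leaves;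
* `baumertHallFamily668_summary` — one conjunction (citation point);
* (+) CONTROL of the pipeline in the kernel: `tmatrixRows_three`, `bhArray_three` (the Baumert–Hall array of order 3,
  `OD(12; 3,3,3,3)`, from the T-matrices `I, P, P², 0`), `williamsonType_three` (`A = B = C = J - 2I`, `D = J`),
  **`hadamard36_plugIn_control`** — `H(36)` = `BH(12) ⊗ Williamson(3)` by Corollary 3.6 with `t = w = 3`.
TERMINOLOGY: "Williamson-type" here is SY 2020 Definition 3.2 (amicability); the gen-21 dictionary's "Williamson-type
SHAPE" (`Order167WilliamsonType668`: four circulant blocks of order 167 in the `V₄` arrangement up to a sign table) is a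
statement about automorphisms and is not the same notion.  Typed skeleton + kernel re-derivation of published theorems;
no order excluded; H(668) untouched; HITS 0/4.  No `sorry`, no new axioms.
-/

open Matrix BigOperators Finset

namespace Summit.Ventures.DiscreteObjects.Hadamard

open Literature.Combinatorics.Designs.GoethalsSeidel (IsHadamardMatrix)
open Literature.Combinatorics.Designs.TMatrices (IsTMatrixRows)
open Literature.Combinatorics.Designs.OrthogonalDesigns (IsBHArray IsWilliamsonType plugIn plugIn_isHadamard
  exists_hadamard_of_bhArray exists_hadamard_of_williamsonType exists_hadamard_of_bhArray_williamsonType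
  isWilliamsonType_one)
open Literature.Combinatorics.Designs.CooperWallis (cwCoef cwCoef_isBHArray exists_hadamard_of_tmatrixRows_williamsonType)

/-! ## The order equation `4·t·w = 668` -/

/-- **the plug-in step degenerates at 668**: `4·t·w = 668` iff `(t, w) = (1, 167)` or `(167, 1)` (`167` is prime). -/
theorem plugIn_orders_668 (t w : ℕ) : 4 * t * w = 668 ↔ (t = 1 ∧ w = 167) ∨ (t = 167 ∧ w = 1) := by
  constructor
  · intro h
    have htw : t * w = 167 := Nat.eq_of_mul_eq_mul_left (by norm_num : 0 < 4) (by rw [← mul_assoc, h])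
    have hp : Nat.Prime 167 := by norm_num
    rcases hp.eq_one_or_self_of_dvd t ⟨w, htw.symm⟩ with ht | ht <;> subst ht
    · left; exact ⟨rfl, by simpa using htw⟩
    · right; exact ⟨rfl, by omega⟩
  · rintro (⟨rfl, rfl⟩ | ⟨rfl, rfl⟩) <;> norm_num

/-! ## Leaf `w = 1`: a Baumert–Hall array of order 167 -/

/-- **leaf `w = 1`.**  A Baumert–Hall array `BH(668; 167, 167, 167, 167)` (an `OD(4t; t,t,t,t)` with `t = 167`, on any
index type of size `668`, from any source) gives a Hadamard matrix of order `668` (all variables set to `1`). -/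
theorem hadamard668_of_bhArray167 {ι : Type*} [Fintype ι] [DecidableEq ι] {P : Fin 4 → Matrix ι ι ℤ}
    (hP : IsBHArray 167 P) :
    ∃ H : Matrix (ι × Fin 1) (ι × Fin 1) ℤ, IsHadamardMatrix H ∧ Fintype.card (ι × Fin 1) = 668 := by
  obtain ⟨H, hH, hc⟩ := exists_hadamard_of_bhArray hP
  exact ⟨H, hH, by rw [hc]⟩

/-! ## Leaf `t = 1`: Williamson-type matrices of order 167 -/

/-- **leaf `t = 1`.**  Williamson-type matrices of order `167` — four pairwise amicable `±1` matrices `X₀, …, X₃` on an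
index type of size `167` with `Σ X_m X_mᵀ = 668 I` (Seberry–Yamada Definition 3.2; no circulant or symmetric structure
assumed) — give, in the Williamson array, a Hadamard matrix of order `668` (SY Theorem 3.2). -/
theorem hadamard668_of_williamsonType167 {κ : Type*} [Fintype κ] [DecidableEq κ] (hκ : Fintype.card κ = 167)
    {X : Fin 4 → Matrix κ κ ℤ} (hX : IsWilliamsonType X) :
    ∃ H : Matrix (Fin 4 × κ) (Fin 4 × κ) ℤ, IsHadamardMatrix H ∧ Fintype.card (Fin 4 × κ) = 668 := by
  obtain ⟨H, hH, hc⟩ := exists_hadamard_of_williamsonType hX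
  exact ⟨H, hH, by rw [hc, hκ]⟩

/-- the trivial T-matrices of order `1`: `T₁ = (1)`, `T₂ = T₃ = T₄ = (0)`. -/
theorem tmatrixRows_one : IsTMatrixRows 1 (fun k (_ : ZMod 1) => if k = 0 then (1 : ℤ) else 0) := by
  refine ⟨fun i => ⟨0, by simp, fun k' hk' => by simp [hk']⟩, fun s hs => ?_⟩
  exact absurd (Subsingleton.elim s 0) hs

/-- the Baumert–Hall array of order `1` produced by Cooper–Wallis from the trivial T-matrices: this is the `OD(4; 1,1,1,1)`,
i.e. the Williamson array with variables (SY Example 1.27 (ii), §4.2.1 (i)). -/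
theorem bhArray_one : IsBHArray 1 (cwCoef fun k (_ : ZMod 1) => if k = 0 then (1 : ℤ) else 0) :=
  cwCoef_isBHArray tmatrixRows_one

/-- leaf `t = 1` through the general machinery (Corollary 3.6 with the order-`1` T-matrices): Williamson-type matrices of
order `167` give a Hadamard matrix on `(Fin 4 × ZMod 1) × κ`, of order `668`. -/
theorem hadamard668_of_williamsonType167' {κ : Type*} [Fintype κ] [DecidableEq κ] (hκ : Fintype.card κ = 167)
    {X : Fin 4 → Matrix κ κ ℤ} (hX : IsWilliamsonType X) :
    ∃ H : Matrix ((Fin 4 × ZMod 1) × κ) ((Fin 4 × ZMod 1) × κ) ℤ,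
      IsHadamardMatrix H ∧ Fintype.card ((Fin 4 × ZMod 1) × κ) = 668 := by
  obtain ⟨H, hH, hc⟩ := exists_hadamard_of_tmatrixRows_williamsonType tmatrixRows_one hX
  exact ⟨H, hH, by rw [hc, hκ]⟩

/-! ## The general Corollary 3.6 instance at 668 -/

/-- **Corollary 3.6 at order 668.**  First rows of T-matrices of order `t` and Williamson-type matrices of order `w` with
`4tw = 668` give a Hadamard matrix of order `668` — and then `(t, w) ∈ {(1, 167), (167, 1)}`: the general plug-in route
to `668` is the union of the two leaves (T-matrices of order 167, typed in `TurynTypeFamily668`; Williamson-type matrices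
of order 167, `hadamard668_of_williamsonType167`). -/
theorem hadamard668_of_tmatrixRows_williamsonType {t : ℕ} [NeZero t] {T : Fin 4 → ZMod t → ℤ}
    (hT : IsTMatrixRows t T) {κ : Type*} [Fintype κ] [DecidableEq κ] {X : Fin 4 → Matrix κ κ ℤ}
    (hX : IsWilliamsonType X) (h : 4 * t * Fintype.card κ = 668) :
    (∃ H : Matrix ((Fin 4 × ZMod t) × κ) ((Fin 4 × ZMod t) × κ) ℤ,
        IsHadamardMatrix H ∧ Fintype.card ((Fin 4 × ZMod t) × κ) = 668) ∧
      ((t = 1 ∧ Fintype.card κ = 167) ∨ (t = 167 ∧ Fintype.card κ = 1)) := by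
  obtain ⟨H, hH, hc⟩ := exists_hadamard_of_tmatrixRows_williamsonType hT hX
  exact ⟨⟨H, hH, by rw [hc, h]⟩, (plugIn_orders_668 t _).mp h⟩

/-- the same for a Baumert–Hall array of order `t` from any source and Williamson-type matrices of order `w`,
`4tw = 668`. -/
theorem hadamard668_of_bhArray_williamsonType {ι : Type*} [Fintype ι] [DecidableEq ι] {t : ℕ}
    {P : Fin 4 → Matrix ι ι ℤ} (hP : IsBHArray t P) {κ : Type*} [Fintype κ] [DecidableEq κ]
    {X : Fin 4 → Matrix κ κ ℤ} (hX : IsWilliamsonType X) (h : 4 * t * Fintype.card κ = 668) :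
    (∃ H : Matrix (ι × κ) (ι × κ) ℤ, IsHadamardMatrix H ∧ Fintype.card (ι × κ) = 668) ∧
      ((t = 1 ∧ Fintype.card κ = 167) ∨ (t = 167 ∧ Fintype.card κ = 1)) := by
  obtain ⟨H, hH, hc⟩ := exists_hadamard_of_bhArray_williamsonType hP hX
  exact ⟨⟨H, hH, by rw [hc, h]⟩, (plugIn_orders_668 t _).mp h⟩

/-! ## Summary -/

/-- **The Baumert–Hall plug-in family at 668 (summary; citation point).**  (i) `4tw = 668 ⇔ (t,w) ∈ {(1,167), (167,1)}`;
(ii) a Baumert–Hall array of order `167` gives `H(668)`; (iii) Williamson-type matrices of order `167` (pairwise amicable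
`±1` matrices with `Σ X Xᵀ = 668 I`) give `H(668)`; (iv) the order-`1` Cooper–Wallis array is a Baumert–Hall array
(`OD(4; 1,1,1,1)`).  Neither leaf object is known in print; no order is excluded; H(668) untouched.
lottery ticket; floor = certified bounds/negative ranges. -/
theorem baumertHallFamily668_summary :
    (∀ t w : ℕ, 4 * t * w = 668 ↔ (t = 1 ∧ w = 167) ∨ (t = 167 ∧ w = 1)) ∧
    (∀ {ι : Type} [Fintype ι] [DecidableEq ι] {P : Fin 4 → Matrix ι ι ℤ}, IsBHArray 167 P →
        ∃ H : Matrix (ι × Fin 1) (ι × Fin 1) ℤ, IsHadamardMatrix H ∧ Fintype.card (ι × Fin 1) = 668) ∧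
    (∀ {X : Fin 4 → Matrix (ZMod 167) (ZMod 167) ℤ}, IsWilliamsonType X →
        ∃ H : Matrix (Fin 4 × ZMod 167) (Fin 4 × ZMod 167) ℤ,
          IsHadamardMatrix H ∧ Fintype.card (Fin 4 × ZMod 167) = 668) ∧
    IsBHArray 1 (cwCoef fun k (_ : ZMod 1) => if k = 0 then (1 : ℤ) else 0) :=
  ⟨plugIn_orders_668, fun hP => hadamard668_of_bhArray167 hP,
    fun hX => hadamard668_of_williamsonType167 (by simp [ZMod.card]) hX, bhArray_one⟩

/-! ## (+) control of the plug-in pipeline: `H(36)` from T-matrices of order 3 and Williamson matrices of order 3 -/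

/-- the circulant T-matrices of order `3`: `T₁ = I`, `T₂ = P`, `T₃ = P²`, `T₄ = 0` (SY 2020 §4.2.1 (iii), the Cooper–Wallis
derivation of the Baumert–Hall array `OD(12; 3,3,3,3)`), as first rows `(δ₀, δ₁, δ₂, 0)` (kernel check). -/
theorem tmatrixRows_three :
    IsTMatrixRows 3 ![fun x => if x = 0 then 1 else 0, fun x => if x = 1 then 1 else 0,
      fun x => if x = 2 then 1 else 0, fun _ => (0 : ℤ)] := by
  constructor <;> decide

/-- **(+) control, step 1: the Baumert–Hall array of order 3** (`OD(12; 3, 3, 3, 3)`, Baumert–Hall's original order) produced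
by the kernel Cooper–Wallis construction from the T-matrices of order `3`. -/
theorem bhArray_three :
    IsBHArray 3 (cwCoef (![fun x => if x = 0 then 1 else 0, fun x => if x = 1 then 1 else 0,
      fun x => if x = 2 then 1 else 0, fun _ => 0] : Fin 4 → ZMod 3 → ℤ)) :=
  cwCoef_isBHArray tmatrixRows_three

/-- the Williamson matrices of order `3`: `A = B = C` with first row `(-1, 1, 1)` (i.e. `J - 2I`) and `D = J`
(`3 (J - 2I)² + J² = 12 I`), as Williamson-type matrices (kernel check of Definition 3.2 on `3 × 3` circulants). -/
theorem williamsonType_three :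
    IsWilliamsonType ![Matrix.circulant (![-1, 1, 1] : ZMod 3 → ℤ), Matrix.circulant (![-1, 1, 1] : ZMod 3 → ℤ),
      Matrix.circulant (![-1, 1, 1] : ZMod 3 → ℤ), Matrix.circulant (![1, 1, 1] : ZMod 3 → ℤ)] := by
  refine ⟨?_, ?_, ?_⟩ <;> decide

/-- **(+) CONTROL of the plug-in family: a Hadamard matrix of order `36 = 4·3·3`** obtained IN THE KERNEL by plugging the
Williamson matrices of order `3` into the Cooper–Wallis Baumert–Hall array of order `3` (Corollary 3.6 with `t = w = 3`) —
the same pipeline that at `668` would need `(t, w) ∈ {(1, 167), (167, 1)}`. -/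
theorem hadamard36_plugIn_control :
    IsHadamardMatrix (plugIn
      (cwCoef (![fun x => if x = 0 then 1 else 0, fun x => if x = 1 then 1 else 0,
        fun x => if x = 2 then 1 else 0, fun _ => 0] : Fin 4 → ZMod 3 → ℤ))
      ![Matrix.circulant (![-1, 1, 1] : ZMod 3 → ℤ), Matrix.circulant (![-1, 1, 1] : ZMod 3 → ℤ),
        Matrix.circulant (![-1, 1, 1] : ZMod 3 → ℤ), Matrix.circulant (![1, 1, 1] : ZMod 3 → ℤ)]) ∧
      Fintype.card ((Fin 4 × ZMod 3) × ZMod 3) = 36 :=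
  ⟨Literature.Combinatorics.Designs.CooperWallis.hadamard_of_tmatrixRows_williamsonType tmatrixRows_three
    williamsonType_three, by simp [Fintype.card_prod, ZMod.card]⟩

end Summit.Ventures.DiscreteObjects.Hadamard
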